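import Literature.NumberTheory.EllipticCurves.TianYuanZhang2017.CMPointClassFieldTorsion
import HarnessLib

/-!
# Route B's displayed hypothesis REDUCED A THIRD TIME: the inclusion «`(β+1)A[4] ⊆ A[2]`» of the `β′`-facts (`n` even)
# is a kernel theorem of «`β` acts on `ℚ(i)` trivially» and the `2`-torsion of `A` — the named fact
# `tyz_cmPointClassFieldDataBeta` ⟺ `tyz_cmPointClassFieldDataTorsion` ⟺ … ⟺ `tyz_cmPointClassFieldData`

A THIRD derivability pass over route B's displayed hypothesis (cell `bsd-monsky`, typer seat g17; the earlier passes are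
`CMPointClassFieldReduced.lean` (hCF′) and `CMPointClassFieldTorsion.lean` (hCF″)).  `GenusPointData.betaSpec` displays the
Galois facts on `β′` used in the proof of [TianYuanZhang2017] Thm. 3.5 (2): «`β` acts on `K_n` by `√−n ↦ −√−n`» (p0020 L118),
«`β` acts on `ℚ(i)` trivially» (p0020 L121) and, for `n` even, the SET IDENTITY «`(β+1)A[4] = A[2]`» (p0020 L146: «`P(n)^β +
P(n) ∈ (β+1)A[4] = A[2]` by Lemma 3.17») rendered as two inclusions — `(β+1)A[4] ⊆ A[2]` («`∀ Q, 4Q = 0 → 2(βQ + Q) = 0`»)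
and `A[2] ⊆ (β+1)A[4]` («`∀ T, 2T = 0 → ∃ Q, 4Q = 0 ∧ βQ + Q = T`»).  The FIRST inclusion is a kernel theorem of the second
displayed sentence and of the `2`-torsion of `A` (`CurveAFourTorsion.lean`): for `4Q = 0`, `2Q ∈ A[2] = {O, (0,0), (2i,0),
(−2i,0)}`, whose coordinates lie in `ℚ(i)` and are fixed by `β` («`β(i) = i`»), so `2(βQ + Q) = β(2Q) + 2Q = 2Q + 2Q = 4Q = 0`
(`two_nsmul_betaPt_add_of_four_nsmul_eq_zero`).  The SECOND inclusion is NOT derivable: the display fixes `β` on `i` and on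
`√−n` but not on `√2` (so not on `A[4]`), and with `β(√2) = −√2` and `β·ptQ = ptQ + (2i, 0)` the image `(β+1)A[4]` would be
`{O, (0,0)}`; it is consumed by no consumer in the tree (information, not minimality).

`betaSpecCore` (= `betaSpec` with the first inclusion struck; the three other conjuncts VERBATIM), `betaSpec_iff_core`,
`PrintedBeta` (= `PrintedTorsion` with `betaSpec ↦ betaSpecCore`), and the named fact **hCF‴ = `tyz_cmPointClassFieldDataBeta`**
with `tyz_cmPointClassFieldDataTorsion_iff_beta` and `tyz_cmPointClassFieldData_iff_beta` (hCF ⟺ hCF′ ⟺ hCF″ ⟺ hCF‴ in the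
kernel).  HONEST ACCOUNTING: the struck conjunct is HALF of a printed identity («`(β+1)A[4] = A[2]`») — a content removal;
the other half stays displayed.  HONEST FRAMING: hCF‴ is a named fact with NO `_holds`; consumers take it as a hypothesis;
every consumer of `tyz_cmPointClassFieldData` runs unchanged through `tyz_cmPointClassFieldData_of_beta`.  Origin: cell
`bsd-monsky` (run/shared/lean/pub/bsd-monsky/), typer seat g17.

References: [TianYuanZhang2017] proof of Thm. 3.5 (2) (p0020 L107–L122, L143–L148), Lemma 3.16 (p0017 L98–L101), Lemma 3.17
(p0017 L136–L149); [SilvermanAEC2009] III.2.3.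
-/

noncomputable section

open scoped Classical

open WeierstrassCurve WeierstrassCurve.Affine

namespace Literature.NumberTheory.EllipticCurves.TianYuanZhang2017

namespace GenusPointData

variable {n : ℕ}

/-! ## §1 `β` fixes `A[2]`, hence `(β+1)A[4] ⊆ A[2]` -/

/-- **`β` fixes every `2`-torsion point of `A(ℍ′_n)`**: `A[2] = {O, (0,0), (2i,0), (−2i,0)}` has coordinates in `ℚ(i)`, and
`β(i) = i`. [cite: TianYuanZhang2017, proof of Thm. 3.5 (2) (p0020 L121: «`β` acts on `ℚ(i)` trivially»), Lemma 3.16 (p0017 L98–L101)] -/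
theorem betaPt_eq_self_of_two_nsmul_eq_zero (D : GenusPointData n) (hβi : D.beta D.im = D.im) {T : APoint D.H}
    (hT : (2 : ℕ) • T = 0) : D.betaPt T = T := by
  have hfix : ∀ {x : D.H} (h : (curveA.baseChange D.H).toAffine.Nonsingular x 0), D.beta x = x →
      D.betaPt (Point.some x 0 h) = Point.some x 0 h := by
    intro x h hx
    change Point.map D.beta.toAlgHom (Point.some x 0 h) = _
    rw [Point.map_some, Point.some.injEq]
    exact ⟨hx, map_zero _⟩
  rcases eq_of_two_nsmul_eq_zero D.im D.im_sq hT with h | h | h | h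
  · rw [h]; exact map_zero _
  · rw [h, tauOne]; exact hfix _ (map_zero _)
  · rw [h, ptTwoI]; exact hfix _ (by rw [map_mul, hβi, map_ofNat])
  · rw [h, ptNegTwoI]; exact hfix _ (by rw [map_neg, map_mul, hβi, map_ofNat])

/-- **«`(β+1)A[4] ⊆ A[2]`» is a kernel theorem of «`β(i) = i`»**: for `4Q = 0`, `2(βQ + Q) = β(2Q) + 2Q = 4Q = 0`.
[cite: TianYuanZhang2017, proof of Thm. 3.5 (2) (p0020 L121, L146), Lemma 3.16 (p0017 L98–L101)] -/
theorem two_nsmul_betaPt_add_of_four_nsmul_eq_zero (D : GenusPointData n) (hβi : D.beta D.im = D.im) {Q : APoint D.H}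
    (hQ : (4 : ℕ) • Q = 0) : (2 : ℕ) • (D.betaPt Q + Q) = 0 := by
  have h2 : (2 : ℕ) • ((2 : ℕ) • Q) = 0 := by rw [smul_smul]; exact hQ
  rw [smul_add, ← map_nsmul, D.betaPt_eq_self_of_two_nsmul_eq_zero hβi h2, ← two_nsmul, smul_smul]
  exact hQ

/-! ## §2 The `β′`-facts with the derivable inclusion struck -/

/-- **`betaSpec` with «`(β+1)A[4] ⊆ A[2]`» struck**: «`β` acts on `K_n` by `√−n ↦ −√−n`», «`β` acts on `ℚ(i)` trivially», and
for `n` even the inclusion «`A[2] ⊆ (β+1)A[4]`» (the three other conjuncts of `betaSpec` VERBATIM). A predicate; nothing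
asserted. [cite: TianYuanZhang2017, proof of Thm. 3.5 (2) (chunk p0020 L107–L122, L143–L148); Lemma 3.17 (p0017 L136–L149)] -/
def betaSpecCore (D : GenusPointData n) : Prop :=
  (n ∈ n.divisors → D.beta (D.sqrtNeg n) = -D.sqrtNeg n) ∧
  D.beta D.im = D.im ∧
  (Even n → ∀ T : APoint D.H, (2 : ℕ) • T = 0 → ∃ Q : APoint D.H, (4 : ℕ) • Q = 0 ∧ D.betaPt Q + Q = T)

/-- `betaSpec ⟹ betaSpecCore` (drop the inclusion). [cite: TianYuanZhang2017, proof of Thm. 3.5 (2) (p0020 L146)] -/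
theorem betaSpecCore_of_betaSpec (D : GenusPointData n) (h : D.betaSpec) : D.betaSpecCore :=
  ⟨h.1, h.2.1, fun heven => (h.2.2 heven).2⟩

/-- **`betaSpecCore ⟹ betaSpec`**: the struck inclusion from «`β(i) = i`». [cite: TianYuanZhang2017, proof of Thm. 3.5 (2) (p0020 L121, L146)] -/
theorem betaSpec_of_core (D : GenusPointData n) (h : D.betaSpecCore) : D.betaSpec :=
  ⟨h.1, h.2.1, fun heven => ⟨fun _ hQ => D.two_nsmul_betaPt_add_of_four_nsmul_eq_zero h.2.1 hQ, h.2.2 heven⟩⟩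

/-- **`betaSpec ⟺ betaSpecCore`.** [cite: TianYuanZhang2017, proof of Thm. 3.5 (2) (p0020 L107–L122, L143–L148)] -/
theorem betaSpec_iff_core (D : GenusPointData n) : D.betaSpec ↔ D.betaSpecCore :=
  ⟨D.betaSpecCore_of_betaSpec, D.betaSpec_of_core⟩

/-- **`PrintedTorsion` with `betaSpec ↦ betaSpecCore`** (the nine other conjuncts VERBATIM, in the same order). A predicate;
nothing asserted. [cite: TianYuanZhang2017, §3 (Prop. 3.4, Thm. 3.5, Lemma 3.18, Lemma 3.21, proof of Thm. 3.5 (2))] -/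
def PrintedBeta (D : GenusPointData n) : Prop :=
  D.scriptLSpec ∧ D.epsSpec ∧ D.recursion ∧ D.prop34 ∧ D.thm35Main ∧ D.thm35Bullet1 ∧
    D.thm35Bullet2Ie ∧ D.lemma318Core ∧ D.betaSpecCore ∧ D.lemma321

/-- `PrintedTorsion ⟹ PrintedBeta`. [cite: TianYuanZhang2017, §3] -/
theorem printedBeta_of_printedTorsion (D : GenusPointData n) (h : D.PrintedTorsion) : D.PrintedBeta := by
  obtain ⟨h1, h2, h3, h4, h5, h6, h7, h8, h9, h10⟩ := h
  exact ⟨h1, h2, h3, h4, h5, h6, h7, h8, D.betaSpecCore_of_betaSpec h9, h10⟩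

/-- `PrintedBeta ⟹ PrintedTorsion`. [cite: TianYuanZhang2017, proof of Thm. 3.5 (2) (p0020 L121, L146)] -/
theorem printedTorsion_of_printedBeta (D : GenusPointData n) (h : D.PrintedBeta) : D.PrintedTorsion := by
  obtain ⟨h1, h2, h3, h4, h5, h6, h7, h8, h9, h10⟩ := h
  exact ⟨h1, h2, h3, h4, h5, h6, h7, h8, D.betaSpec_of_core h9, h10⟩

/-- **`PrintedTorsion ⟺ PrintedBeta`.** [cite: TianYuanZhang2017, §3] -/
theorem printedTorsion_iff_printedBeta (D : GenusPointData n) : D.PrintedTorsion ↔ D.PrintedBeta :=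
  ⟨D.printedBeta_of_printedTorsion, D.printedTorsion_of_printedBeta⟩

end GenusPointData

/-! ## §3 The ONE named fact, and its equivalences -/

/-- **Tian–Yuan–Zhang 2017, §3 with the CM-point layer and its class fields AS PRINTED, REDUCED THREE TIMES, as ONE named
fact**: for every positive square-free `n ≡ 5, 6, 7 (mod 8)` there are data `D : GenusPointData n` satisfying `PrintedBeta`
and `CMPointClassFieldPrintedTorsion`.  EQUIVALENT in the kernel to `tyz_cmPointClassFieldDataTorsion`,
`tyz_cmPointClassFieldDataReduced` and `tyz_cmPointClassFieldData`; no `_holds` expected; consumers take it as an explicit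
hypothesis; nothing is asserted here.
[cite: TianYuanZhang2017, §3: §3.1 (J738–J739), Prop. 3.2, Prop. 3.4, Thm. 3.5 and the proof of Thm. 3.5 (2) (p0020 L107–L122, L143–L148), Thm. 3.6 (J741), Lemma 3.16, Lemma 3.18, Lemma 3.21 and its proof (J759), §2.1 (J725)]
[cite: Cox2013, Theorem 6.1 (ii), Theorem 9.18, Lemma 9.3, (5.12)] -/
def tyz_cmPointClassFieldDataBeta : Prop :=
  ∀ (n : ℕ), Squarefree n → (n % 8 = 5 ∨ n % 8 = 6 ∨ n % 8 = 7) →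
    ∃ D : GenusPointData n, D.PrintedBeta ∧ D.CMPointClassFieldPrintedTorsion

/-- `tyz_cmPointClassFieldDataBeta ⟹ tyz_cmPointClassFieldDataTorsion`. [cite: TianYuanZhang2017, proof of Thm. 3.5 (2) (p0020 L121, L146)] -/
theorem tyz_cmPointClassFieldDataTorsion_of_beta (h : tyz_cmPointClassFieldDataBeta) :
    tyz_cmPointClassFieldDataTorsion := by
  intro n hn h8
  obtain ⟨D, hD, hC⟩ := h n hn h8
  exact ⟨D, D.printedTorsion_of_printedBeta hD, hC⟩

/-- `tyz_cmPointClassFieldDataTorsion ⟹ tyz_cmPointClassFieldDataBeta`. [cite: TianYuanZhang2017, §3] -/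
theorem tyz_cmPointClassFieldDataBeta_of_torsion (h : tyz_cmPointClassFieldDataTorsion) :
    tyz_cmPointClassFieldDataBeta := by
  intro n hn h8
  obtain ⟨D, hD, hC⟩ := h n hn h8
  exact ⟨D, D.printedBeta_of_printedTorsion hD, hC⟩

/-- **`tyz_cmPointClassFieldDataTorsion ⟺ tyz_cmPointClassFieldDataBeta`** in the kernel. [cite: TianYuanZhang2017, §3] -/
theorem tyz_cmPointClassFieldDataTorsion_iff_beta :
    tyz_cmPointClassFieldDataTorsion ↔ tyz_cmPointClassFieldDataBeta :=
  ⟨tyz_cmPointClassFieldDataBeta_of_torsion, tyz_cmPointClassFieldDataTorsion_of_beta⟩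

/-- `tyz_cmPointClassFieldDataBeta ⟹ tyz_cmPointClassFieldData` (the direction the doors use). [cite: TianYuanZhang2017, §3] -/
theorem tyz_cmPointClassFieldData_of_beta (h : tyz_cmPointClassFieldDataBeta) : tyz_cmPointClassFieldData :=
  tyz_cmPointClassFieldData_of_torsion (tyz_cmPointClassFieldDataTorsion_of_beta h)

/-- **`tyz_cmPointClassFieldData ⟺ tyz_cmPointClassFieldDataBeta`** in the kernel. [cite: TianYuanZhang2017, §3] -/
theorem tyz_cmPointClassFieldData_iff_beta : tyz_cmPointClassFieldData ↔ tyz_cmPointClassFieldDataBeta :=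
  tyz_cmPointClassFieldData_iff_torsion.trans tyz_cmPointClassFieldDataTorsion_iff_beta

end Literature.NumberTheory.EllipticCurves.TianYuanZhang2017

end
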